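import Mathlib
import Summits.PneNP.PneNP.Theses.AeaCutRectangles
import Summits.PneNP.PneNP.Theorems.AeaCutRectanglesDutyRectangles

/-!
# Sketch (crux-ideate round 2, seat 2, g3; g4: symmetry + triangle-freeness) — NORMAL CYCLE SYSTEMS ("non-abelian DMP rulers")

First lemma for the crux idea card `normal-cycle-systems` on `stmt-PneNP-19727`
(`Summit.PneNP.PneNP.Theses.AeaCutRectangles.FoolingMeasure`).  Restricted-model rung; nothing here bears on P vs NP.

A *cycle system* is `t` cyclic orders ("rulers") of `Fin (3q+1)`; its graph is the union of the `t` Hamiltonian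
cycles.  It is NORMAL when, along every ruler `i`, every edge of every other cycle spans a forward distance
`≡ 2 (mod 3)`.  For the circulants `C(3q+1; D)` of De Agostino–Machì–Petreschi the rulers are the multiplier maps
`v ↦ (q·a⁻¹)·v`, `a ∈ D`, and normality is their "middle third" condition; here no group is involved.
`normal_erase_colorable`: in a normal system EVERY edge is critical (deleting it leaves a 3-colourable graph), so a
normal system is 4-critical as soon as it is not 3-colourable — criticality is certified by the rulers, for free.
-/

namespace Summit.PneNP.PneNP.Cruxes.FoolingMeasure.IdeasR2g3

open Finset
open Fin.CommRing
open Summit.PneNP.PneNP.Theorems.AeaCutRectanglesDutyRectangles (bobSide)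

/-- 3-colourability of the graph spanned by an edge set over `Fin n` (as in the route file). -/
abbrev Col3 {n : ℕ} (G : Finset (Sym2 (Fin n))) : Prop :=
  (SimpleGraph.fromEdgeSet (G : Set (Sym2 (Fin n)))).Colorable 3

/-- `t` rulers of `Fin (3q+1)`: `pos k v` is the index of `v` along cycle `k`. -/
structure CycleSystem (q t : ℕ) where
  pos : Fin t → Equiv.Perm (Fin (3 * q + 1))

namespace CycleSystem

variable {q t : ℕ} (S : CycleSystem q t)

/-- successor of `v` along cycle `k`. -/
def succ (k : Fin t) (v : Fin (3 * q + 1)) : Fin (3 * q + 1) := (S.pos k).symm (S.pos k v + 1)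

/-- the graph of the system: the union of its `t` Hamiltonian cycles, as an edge set. -/
def edges : Finset (Sym2 (Fin (3 * q + 1))) :=
  (Finset.univ : Finset (Fin t × Fin (3 * q + 1))).image fun p => s(p.2, S.succ p.1 p.2)

/-- NORMALITY ("jump ≡ 2 mod 3"): along ruler `i`, each edge of each other cycle `k` spans a forward distance
`≡ 2 (mod 3)` (the condition is symmetric in the edge's endpoints since `3q+1 ≡ 1 (mod 3)`). -/
def Normal : Prop :=
  ∀ i k : Fin t, i ≠ k → ∀ v : Fin (3 * q + 1), (S.pos i (S.succ k v) - S.pos i v).val % 3 = 2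

theorem pos_succ (k : Fin t) (v : Fin (3 * q + 1)) : S.pos k (S.succ k v) = S.pos k v + 1 := by
  simp [succ]

end CycleSystem

variable {q t : ℕ}

/-- the seam colouring of ruler `k` based at the edge `{v, succ_k v}`: colour(w) = (pos_k w − pos_k v − 1) mod 3.
It is proper on every edge of a normal system except `{v, succ_k v}` itself. -/
def seamColour (S : CycleSystem q t) (k : Fin t) (v w : Fin (3 * q + 1)) : Fin 3 :=
  ⟨(S.pos k w - S.pos k v - 1).val % 3, Nat.mod_lt _ (by norm_num)⟩

theorem seam_proper (S : CycleSystem q t) (hq : 1 ≤ q) (hN : S.Normal) (k : Fin t) (v : Fin (3 * q + 1))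
    (i : Fin t) (u : Fin (3 * q + 1)) (hu : ¬ (i = k ∧ u = v)) :
    seamColour S k v u ≠ seamColour S k v (S.succ i u) := by
  intro h
  have hval : (S.pos k u - S.pos k v - 1).val % 3 = (S.pos k (S.succ i u) - S.pos k v - 1).val % 3 :=
    congrArg Fin.val h
  have hB : S.pos k (S.succ i u) - S.pos k v - 1 =
      (S.pos k u - S.pos k v - 1) + (S.pos k (S.succ i u) - S.pos k u) := by ring
  rw [hB, Fin.val_add] at hval
  set A := S.pos k u - S.pos k v - 1 with hA
  set D := S.pos k (S.succ i u) - S.pos k u with hD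
  have hAlt := A.isLt
  have hDlt := D.isLt
  by_cases hik : i = k
  · subst hik
    have hD1 : D = 1 := by rw [hD, S.pos_succ]; ring
    have huv : u ≠ v := fun h' => hu ⟨rfl, h'⟩
    have h1v : (1 : Fin (3 * q + 1)).val = 1 := by
      rw [Fin.val_one']; exact Nat.mod_eq_of_lt (by omega)
    have hA3q : A.val ≠ 3 * q := by
      intro h3
      apply huv
      have hneg : A = -1 := by
        apply Fin.ext
        rw [h3, Fin.coe_neg_one]
      have hpos : S.pos i u = S.pos i v := by
        have := hneg
        rw [hA] at this
        linear_combination this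
      exact (S.pos i).injective hpos
    have hA1 : A.val + 1 < 3 * q + 1 := by omega
    rw [hD1, h1v, Nat.mod_eq_of_lt hA1] at hval
    omega
  · have hD2 : D.val % 3 = 2 := hN k i (Ne.symm hik) u
    by_cases hlt : A.val + D.val < 3 * q + 1
    · rw [Nat.mod_eq_of_lt hlt] at hval
      omega
    · have hmod : (A.val + D.val) % (3 * q + 1) = A.val + D.val - (3 * q + 1) := by
        rw [Nat.mod_eq_sub_mod (by omega)]
        exact Nat.mod_eq_of_lt (by omega)
      rw [hmod] at hval
      omega

/-- **Criticality for free.** In a normal cycle system every edge is critical: deleting it leaves a 3-colourable graph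
(DMP's Lemma 1, without the group).  Hence a normal system is 4-critical iff it is not 3-colourable. -/
theorem normal_erase_colorable (S : CycleSystem q t) (hq : 1 ≤ q) (hN : S.Normal) :
    ∀ e ∈ S.edges, Col3 (S.edges.erase e) := by
  intro e he
  obtain ⟨⟨k, v⟩, -, rfl⟩ := Finset.mem_image.mp he
  refine ⟨SimpleGraph.Coloring.mk (seamColour S k v) ?_⟩
  intro x y hadj
  rw [SimpleGraph.fromEdgeSet_adj] at hadj
  obtain ⟨hmem, _hxy⟩ := hadj
  have hmem' : s(x, y) ∈ S.edges.erase s(v, S.succ k v) := hmem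
  obtain ⟨hne, hG⟩ := Finset.mem_erase.mp hmem'
  obtain ⟨⟨i, u⟩, -, huw⟩ := Finset.mem_image.mp hG
  have key : ¬ (i = k ∧ u = v) := by
    rintro ⟨rfl, rfl⟩
    exact hne huw.symm
  rcases Sym2.eq_iff.mp huw with ⟨h1, h2⟩ | ⟨h1, h2⟩
  · rw [← h1, ← h2]; exact seam_proper S hq hN k v i u key
  · rw [← h1, ← h2]; exact (seam_proper S hq hN k v i u key).symm

/-- 4-criticality in the route's vocabulary: loopless, not 3-colourable, every single-edge deletion 3-colourable. -/
theorem normal_fourCritical (S : CycleSystem q t) (hq : 1 ≤ q) (hN : S.Normal) (h3 : ¬ Col3 S.edges) :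
    ¬ Col3 S.edges ∧ ∀ e ∈ S.edges, Col3 (S.edges.erase e) :=
  ⟨h3, normal_erase_colorable S hq hN⟩


/-! ### Seam adjacency (the kernel of the interface-certificate lower bound in the card)
Moving the seam of ruler `k` across ONE vertex `b = succ_k a` changes the seam colouring only at `b`
(up to the global colour shift `c ↦ c + 2`): consecutive members of the ruler family are Hamming-adjacent. -/

theorem seamColour_shift (S : CycleSystem q t) (hq : 1 ≤ q) (k : Fin t) (a w : Fin (3 * q + 1))
    (hw : w ≠ S.succ k a) :
    (seamColour S k (S.succ k a) w).val = ((seamColour S k a w).val + 2) % 3 := by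
  unfold seamColour
  simp only
  have h1v : (1 : Fin (3 * q + 1)).val = 1 := by
    rw [Fin.val_one']; exact Nat.mod_eq_of_lt (by omega)
  set X := S.pos k w - S.pos k a - 1 with hX
  have hXb : S.pos k w - S.pos k (S.succ k a) - 1 = X - 1 := by
    rw [S.pos_succ]; ring
  rw [hXb]
  have hX0 : X.val ≠ 0 := by
    intro h0
    apply hw
    have hX0' : X = 0 := Fin.ext (by rw [h0]; rfl)
    have : S.pos k w = S.pos k a + 1 := by
      rw [hX] at hX0'
      linear_combination hX0'
    rw [← S.pos_succ] at this
    exact (S.pos k).injective this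
  have hXlt := X.isLt
  rw [Fin.coe_sub_iff_le.2 (by
    change (1 : Fin (3 * q + 1)).val ≤ X.val
    rw [h1v]; omega), h1v]
  omega

/-! ### Normality is symmetric; normal systems are triangle-free (g4)
Because `3q+1 ≡ 1 (mod 3)`, a jump `d` satisfies `d ≡ 2 (mod 3)` iff the reverse jump `3q+1-d` does: normality is a
condition on UNORDERED pairs.  Consequence: the graph of a normal system has no triangle (two edges of a triangle leave
a common vertex towards the two ends of the third edge, which are consecutive in some ruler, so the two jumps differ by
one and cannot both be `≡ 2`).  So the proposed measure lives on triangle-free `2t`-regular graphs, 4-critical when not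
3-colourable. -/

/-- value of a difference in `Fin (3q+1)`, by cases on the wrap. -/
theorem val_sub_cases (a b : Fin (3 * q + 1)) :
    (a.val ≤ b.val ∧ (b - a).val = b.val - a.val) ∨ (b.val < a.val ∧ (b - a).val = 3 * q + 1 + b.val - a.val) := by
  by_cases h : a ≤ b
  · exact Or.inl ⟨Fin.le_def.1 h, Fin.coe_sub_iff_le.2 h⟩
  · have hlt : b < a := lt_of_not_ge h
    exact Or.inr ⟨Fin.lt_def.1 hlt, Fin.coe_sub_iff_lt.2 hlt⟩

/-- `(x+1) mod (3q+1)`, by cases on the wrap. -/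
theorem succ_mod_cases (x : ℕ) (hx : x < 3 * q + 1) :
    ((x + 1) % (3 * q + 1) = x + 1 ∧ x + 1 < 3 * q + 1) ∨ ((x + 1) % (3 * q + 1) = 0 ∧ x = 3 * q) := by
  by_cases h : x + 1 < 3 * q + 1
  · exact Or.inl ⟨Nat.mod_eq_of_lt h, h⟩
  · right
    have he : x + 1 = 3 * q + 1 := by omega
    exact ⟨by rw [he, Nat.mod_self], by omega⟩

/-- position of the successor, as a natural number. -/
theorem val_pos_succ (S : CycleSystem q t) (hq : 1 ≤ q) (k : Fin t) (v : Fin (3 * q + 1)) :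
    (S.pos k (S.succ k v)).val = ((S.pos k v).val + 1) % (3 * q + 1) := by
  have h1v : (1 : Fin (3 * q + 1)).val = 1 := by
    rw [Fin.val_one']; exact Nat.mod_eq_of_lt (by omega)
  rw [S.pos_succ, Fin.val_add, h1v]

theorem normal_symm (S : CycleSystem q t) (hN : S.Normal) (i k : Fin t) (hik : i ≠ k) (v : Fin (3 * q + 1)) :
    (S.pos i v - S.pos i (S.succ k v)).val % 3 = 2 := by
  have h := hN i k hik v
  have hA := (S.pos i v).isLt
  have hB := (S.pos i (S.succ k v)).isLt
  rcases val_sub_cases (S.pos i v) (S.pos i (S.succ k v)) with ⟨h1, e1⟩ | ⟨h1, e1⟩ <;>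
    rcases val_sub_cases (S.pos i (S.succ k v)) (S.pos i v) with ⟨h2, e2⟩ | ⟨h2, e2⟩ <;>
    rw [e1] at h <;> rw [e2] <;> omega

/-- the ruler-`k` jump from `u` to `c` is `≡ 2 (mod 3)` whenever `{u, c}` is an edge of a cycle `j ≠ k`
(in either orientation). -/
theorem jump_two_of_edge (S : CycleSystem q t) (hN : S.Normal) (k j : Fin t) (hjk : j ≠ k)
    (u c w : Fin (3 * q + 1)) (he : s(u, c) = s(w, S.succ j w)) : (S.pos k c - S.pos k u).val % 3 = 2 := by
  rcases Sym2.eq_iff.mp he with ⟨h1, h2⟩ | ⟨h1, h2⟩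
  · rw [h1, h2]; exact hN k j (Ne.symm hjk) w
  · rw [h1, h2]; exact normal_symm S hN k j (Ne.symm hjk) w

/-- two consecutive cycle-`k` edges are never closed into a triangle: `{u, succ_k (succ_k u)}` is not an edge. -/
theorem succ_succ_not_edge (S : CycleSystem q t) (hq : 1 ≤ q) (hN : S.Normal) (k : Fin t) (u : Fin (3 * q + 1)) :
    s(u, S.succ k (S.succ k u)) ∉ S.edges := by
  intro he
  obtain ⟨⟨j, w⟩, -, hw⟩ := Finset.mem_image.mp he
  dsimp only at hw
  -- positions along ruler k
  have hP := val_pos_succ S hq k u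
  have hP' := val_pos_succ S hq k (S.succ k u)
  have l0 := (S.pos k u).isLt
  have l1 := (S.pos k (S.succ k u)).isLt
  have l2 := (S.pos k (S.succ k (S.succ k u))).isLt
  -- positions along ruler j: the edge {w, succ_j w} = {u, succ_k succ_k u}
  have m0 := (S.pos j u).isLt
  have m1 := (S.pos j (S.succ k u)).isLt
  have m2 := (S.pos j (S.succ k (S.succ k u))).isLt
  have hdiff : (S.pos j (S.succ k (S.succ k u))).val = ((S.pos j u).val + 1) % (3 * q + 1) ∨
      (S.pos j u).val = ((S.pos j (S.succ k (S.succ k u))).val + 1) % (3 * q + 1) := by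
    rcases Sym2.eq_iff.mp hw with ⟨h1, h2⟩ | ⟨h1, h2⟩
    · left
      have h3 := val_pos_succ S hq j w
      rw [h2, h1] at h3; exact h3
    · right
      have h3 := val_pos_succ S hq j w
      rw [h2, h1] at h3; exact h3
  by_cases hjk : j = k
  · subst hjk
    rcases succ_mod_cases (q := q) (S.pos j u).val l0 with ⟨e1, f1⟩ | ⟨e1, f1⟩ <;> rw [e1] at hP <;>
      rcases succ_mod_cases (q := q) (S.pos j (S.succ j u)).val l1 with ⟨e2, f2⟩ | ⟨e2, f2⟩ <;> rw [e2] at hP' <;>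
      rcases succ_mod_cases (q := q) (S.pos j (S.succ j (S.succ j u))).val l2 with ⟨e3, f3⟩ | ⟨e3, f3⟩ <;>
      rcases hdiff with hd | hd <;> (try rw [e1] at hd) <;> (try rw [e3] at hd) <;> omega
  · have hY := hN j k hjk u
    have hZ := hN j k hjk (S.succ k u)
    rcases val_sub_cases (S.pos j u) (S.pos j (S.succ k u)) with ⟨a1, e1⟩ | ⟨a1, e1⟩ <;> rw [e1] at hY <;>
      rcases val_sub_cases (S.pos j (S.succ k u)) (S.pos j (S.succ k (S.succ k u))) with ⟨a2, e2⟩ | ⟨a2, e2⟩ <;>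
      rw [e2] at hZ <;>
      rcases succ_mod_cases (q := q) (S.pos j u).val m0 with ⟨g1, f1⟩ | ⟨g1, f1⟩ <;>
      rcases succ_mod_cases (q := q) (S.pos j (S.succ k (S.succ k u))).val m2 with ⟨g2, f2⟩ | ⟨g2, f2⟩ <;>
      rcases hdiff with hd | hd <;> (try rw [g1] at hd) <;> (try rw [g2] at hd) <;> omega

/-- **Normal systems are triangle-free.** -/
theorem normal_no_triangle (S : CycleSystem q t) (hq : 1 ≤ q) (hN : S.Normal) (a b c : Fin (3 * q + 1))
    (hab : s(a, b) ∈ S.edges) (hac : s(a, c) ∈ S.edges) (hbc : s(b, c) ∈ S.edges)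
    (nac : a ≠ c) (nbc : b ≠ c) : False := by
  obtain ⟨⟨k, u⟩, -, hu⟩ := Finset.mem_image.mp hab
  dsimp only at hu
  have h1v : (1 : Fin (3 * q + 1)).val = 1 := by
    rw [Fin.val_one']; exact Nat.mod_eq_of_lt (by omega)
  -- with u' := succ_k u and {a, b} = {u, u'}: c is adjacent to u and to u'
  have key : ∀ u : Fin (3 * q + 1), s(u, c) ∈ S.edges → s(S.succ k u, c) ∈ S.edges → c ≠ u →
      c ≠ S.succ k u → False := by
    intro u huc hu'c hcu hcu'
    obtain ⟨⟨j, w⟩, -, hw⟩ := Finset.mem_image.mp huc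
    obtain ⟨⟨j', w'⟩, -, hw'⟩ := Finset.mem_image.mp hu'c
    dsimp only at hw hw'
    by_cases hj : j = k
    · subst hj
      rcases Sym2.eq_iff.mp hw with ⟨h1, h2⟩ | ⟨h1, h2⟩
      · -- w = u, succ_j u = c
        exact hcu' (by rw [← h2, h1])
      · -- w = c, succ_j c = u : then {c, succ_j (succ_j c)} = {c, succ_j u} is an edge
        have hsc : S.succ j c = u := by rw [← h1]; exact h2
        have : s(c, S.succ j (S.succ j c)) ∈ S.edges := by rw [hsc, Sym2.eq_swap]; exact hu'c
        exact succ_succ_not_edge S hq hN j c this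
    by_cases hj' : j' = k
    · subst hj'
      rcases Sym2.eq_iff.mp hw' with ⟨h1, h2⟩ | ⟨h1, h2⟩
      · -- w' = succ u, succ (succ u) = c
        have : s(u, S.succ j' (S.succ j' u)) ∈ S.edges := by rw [← h1, h2]; exact huc
        exact succ_succ_not_edge S hq hN j' u this
      · -- w' = c, succ c = succ u ⇒ c = u
        have hsc : S.succ j' c = S.succ j' u := by rw [← h1]; exact h2
        have hcu2 : c = u := by
          have h3 := congrArg (S.pos j') hsc
          rw [S.pos_succ, S.pos_succ] at h3
          exact (S.pos j').injective (add_right_cancel h3)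
        exact hcu hcu2
    -- both chords foreign to k: the ruler-k jumps u → c and succ_k u → c are both ≡ 2, but they differ by 1
    have hX := jump_two_of_edge S hN k j hj u c w hw.symm
    have hX1 := jump_two_of_edge S hN k j' hj' (S.succ k u) c w' hw'.symm
    have hP := val_pos_succ S hq k u
    have l0 := (S.pos k u).isLt
    have l1 := (S.pos k (S.succ k u)).isLt
    have lc := (S.pos k c).isLt
    rcases val_sub_cases (S.pos k u) (S.pos k c) with ⟨a1, e1⟩ | ⟨a1, e1⟩ <;> rw [e1] at hX <;>
      rcases val_sub_cases (S.pos k (S.succ k u)) (S.pos k c) with ⟨a2, e2⟩ | ⟨a2, e2⟩ <;> rw [e2] at hX1 <;>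
      rcases succ_mod_cases (q := q) (S.pos k u).val l0 with ⟨c1, c2⟩ | ⟨c1, c2⟩ <;> rw [c1] at hP <;> omega
  rcases Sym2.eq_iff.mp hu with ⟨h1, h2⟩ | ⟨h1, h2⟩
  · -- u = a, succ_k u = b
    refine key u ?_ ?_ ?_ ?_
    · rw [h1]; exact hac
    · rw [h2]; exact hbc
    · rw [h1]; exact Ne.symm nac
    · rw [h2]; exact Ne.symm nbc
  · -- u = b, succ_k u = a
    refine key u ?_ ?_ ?_ ?_
    · rw [h1]; exact hbc
    · rw [h2]; exact hac
    · rw [h1]; exact Ne.symm nbc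
    · rw [h2]; exact Ne.symm nac

/-- … in Mathlib's vocabulary: the graph of a normal system is `CliqueFree 3`. -/
theorem normal_cliqueFree_three (S : CycleSystem q t) (hq : 1 ≤ q) (hN : S.Normal) :
    (SimpleGraph.fromEdgeSet (S.edges : Set (Sym2 (Fin (3 * q + 1))))).CliqueFree 3 := by
  intro s hs
  obtain ⟨a, b, c, hab, hac, hbc, -⟩ := SimpleGraph.is3Clique_iff.mp hs
  rw [SimpleGraph.fromEdgeSet_adj] at hab hac hbc
  exact normal_no_triangle S hq hN a b c (Finset.mem_coe.mp hab.1) (Finset.mem_coe.mp hac.1)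
    (Finset.mem_coe.mp hbc.1) hac.2 hbc.2

/-! ### The conjectural package the card rests on (EXPERIMENTAL — see the card's kit data; none of this is claimed proved) -/

open scoped Classical in
/-- number of (labelled) normal `t`-systems on `3q+1` points. -/
noncomputable def normalCount (q t : ℕ) : ℕ :=
  (Finset.univ.filter fun P : Fin t → Equiv.Perm (Fin (3 * q + 1)) => (CycleSystem.mk P).Normal).card

open scoped Classical in
/-- … of which 3-colourable. -/
noncomputable def normalColourableCount (q t : ℕ) : ℕ :=
  (Finset.univ.filter fun P : Fin t → Equiv.Perm (Fin (3 * q + 1)) =>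
    (CycleSystem.mk P).Normal ∧ Col3 (CycleSystem.mk P).edges).card

open scoped Classical in
/-- … of which having a SPARSE HALF: some `B` with `|B| ≥ n/2` spanning at most `n/2` edges (the shape that killed
`HalfSparseCore`'s converse; a system without a sparse half is "half-dense critical"). -/
noncomputable def normalSparseHalfCount (q t : ℕ) : ℕ :=
  (Finset.univ.filter fun P : Fin t → Equiv.Perm (Fin (3 * q + 1)) =>
    (CycleSystem.mk P).Normal ∧ ∃ B : Finset (Fin (3 * q + 1)),
      3 * q + 1 ≤ 2 * B.card ∧ 2 * (bobSide B (CycleSystem.mk P).edges).card ≤ 3 * q + 1).card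

/-- ABUNDANCE (first-moment heuristic `(n!)^{t-1}·3^{-t(t-1)n}`, exact counts 2, 22, 800 directed pairs at
`n = 13, 22, 25`): for fixed `t`, normal systems have entropy `(t-1-o(1))·log n!`. -/
def NormalAbundance : Prop :=
  ∀ t : ℕ, 2 ≤ t → ∀ ε : ℝ, 0 < ε → ∀ᶠ q : ℕ in Filter.atTop,
    ((3 * q + 1).factorial : ℝ) ^ ((t : ℝ) - 1 - ε) ≤ (normalCount q t : ℝ)

/-- RIGIDITY: for `t ≥ 3` most normal systems are NOT 3-colourable (hence 4-critical by `normal_fourCritical`). -/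
def NormalMostlyRigid : Prop :=
  ∀ t : ℕ, 3 ≤ t → ∀ᶠ q : ℕ in Filter.atTop, 4 * normalColourableCount q t ≤ normalCount q t

/-- HALF-DENSITY: for `t ≥ 6` most normal systems have no sparse half (circulant members have sparse halves up to
`t = 5`: 0.26n, 0.35n, 0.33–0.39n inside edges at `t = 3, 4, 5`; DMP's `C(12025;…)`, `t = 6`, is certified `≥ 0.556n`). -/
def NormalMostlyHalfDense : Prop :=
  ∀ t : ℕ, 6 ≤ t → ∀ᶠ q : ℕ in Filter.atTop, 4 * normalSparseHalfCount q t ≤ normalCount q t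

/-- HALF-DENSITY from a threshold `t₀` on — the parametrised form of `NormalMostlyHalfDense` (which is the case `t₀ = 6`).
g4 DATA (kit j298030 / j298402 / j298707; annealed upper bounds on the sparsest half `min_B e(G[B])/n`, `|B| ≥ n/2`, of
RANDOM members, n = 199 … 10^6): `c_3 ≈ 0.25–0.26`, `c_4 ≈ 0.341–0.344`, `c_5 ≈ 0.424–0.426` — roughly `1/6 + 0.06·(t-1)`
(two classes of one seam colouring, thinned to alternate along the other rulers), so `t = 6` is marginal (`c_6 ≈ 0.50`
extrapolated) and the card's bet is `t₀ = 7`; any fixed `t₀` serves the card equally. -/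
def NormalHalfDenseFrom (t₀ : ℕ) : Prop :=
  ∀ t : ℕ, t₀ ≤ t → ∀ᶠ q : ℕ in Filter.atTop, 4 * normalSparseHalfCount q t ≤ normalCount q t

theorem normalMostlyHalfDense_iff : NormalMostlyHalfDense ↔ NormalHalfDenseFrom 6 := Iff.rfl

theorem NormalHalfDenseFrom.mono {t₀ t₁ : ℕ} (h : t₀ ≤ t₁) (H : NormalHalfDenseFrom t₀) :
    NormalHalfDenseFrom t₁ :=
  fun t ht => H t (le_trans h ht)

/-- RIGIDITY, g4 DATA (kit j298030): cadical proves NON-3-colourability for 16/16 random normal 3-systems at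
`n = 199, 301` (0.4 s resp. 10–28 s each; `n ≥ 601` times out at 600 s, no colouring found for any of 28 further
members, t = 3, 4) — consistent with the first-moment count `(3·(2/3)^t)^n → 0` of proper 3-colourings for `t ≥ 3`. -/
theorem NormalMostlyRigid_def : NormalMostlyRigid ↔
    ∀ t : ℕ, 3 ≤ t → ∀ᶠ q : ℕ in Filter.atTop, 4 * normalColourableCount q t ≤ normalCount q t := Iff.rfl

end Summit.PneNP.PneNP.Cruxes.FoolingMeasure.IdeasR2g3
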